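import Summits.ABC.ABC.Theorems.TwistAmplificationSharpModerateLawCuspTransfer
import Summits.ABC.ABC.Theorems.TwistAmplificationSharpModerateLawConeDefs

/-!
# Crux `TwistAmplification.SharpModerateLaw` (stmt-ABC-1975), line `syzygy-lattice-half-deep-few-primes`:
the cone-restricted transfer `cuspTransferCone : CuspShellLawCone → SharpModerateLaw`

Same argument as the landed `stub_cuspTransfer` (`…CuspTransfer.lean`), recording that only the CONE of scales
`X³ ≤ 2Y ≤ 2X^σ` is ever used: at the shells `(X_j, 2^j)`, `X_j = min(X, 2^{(j+1)/κ})`, one has `X_j³ ≤ X_j^κ ≤ 2·2^j` and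
`2^j ≤ X_j^σ`.  Hence the honest minimal open core of the line is the cone-restricted spread law `SpreadLawCone`
(`…ConeDefs.lean`), not the two-parameter `SpreadLaw`.
-/

noncomputable section

namespace Summit.ABC.ABC.Theorems.SharpModerateLaw

open WeierstrassCurve IsDedekindDomain Rat.HeightOneSpectrum Real

/-- **`cuspTransferCone`**: the CONE-restricted cusp shell law already implies the crux `SharpModerateLaw` (the transfer only
ever applies the law at scales `(X_j, 2^j)` with `X_j³ ≤ X_j^κ ≤ 2·2^j` and `2^j ≤ X_j^σ`). -/
theorem cuspTransferCone : CuspTransferCone := by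
  intro hlaw κ σ ε hκ3 hκ6 hσ6 hε
  have hκ0 : 0 < κ := by linarith
  have hσ0 : 0 ≤ σ := by linarith
  have hε' : 0 < ε / (2 * (σ + 1)) := by positivity
  obtain ⟨C, hC⟩ := hlaw σ hσ6 (ε / (2 * (σ + 1))) hε'
  set C₀ : ℝ := max C 0 with hC₀
  have hC₀0 : 0 ≤ C₀ := le_max_right _ _
  refine ⟨12 * (3 * C₀) * (2 * σ / (ε * Real.log 2) + 1), fun X hX => ?_⟩
  have hX0 : 0 < X := by linarith
  -- the shells
  set J : ℕ := Nat.log 2 ⌊X ^ σ⌋₊ with hJ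
  set Xj : ℕ → ℝ := fun j => min X ((2 : ℝ) ^ (((j + 1 : ℕ) : ℝ) / κ)) with hXj
  set T : Finset (ℤ × ℤ × ℤ) := ({0, 1} : Finset ℤ) ×ˢ (({-1, 0, 1} : Finset ℤ) ×ˢ ({0, 1} : Finset ℤ))
    with hT
  set U : Set (ℤ × ℤ) := ⋃ j ∈ Finset.range (J + 1), cuspShell (Xj j) ((2 : ℝ) ^ j) with hU
  have hfin : ((↑T : Set (ℤ × ℤ × ℤ)) ×ˢ U).Finite :=
    T.finite_toSet.prod (Set.Finite.biUnion (Finset.range (J + 1)).finite_toSet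
      fun j _ => cuspShell_finite _ _)
  -- Step 1: the window maps injectively into `T × U`
  have hmaps : ∀ W : WeierstrassCurve ℤ, W ∈ {W₀ : WeierstrassCurve ℤ | (W₀.baseChange ℚ).IsElliptic ∧
      (∀ v : IsDedekindDomain.HeightOneSpectrum ℤ, (W₀.baseChange ℚ).IsMinimalAt v) ∧
      (W₀.a₁ = 0 ∨ W₀.a₁ = 1) ∧ (W₀.a₃ = 0 ∨ W₀.a₃ = 1) ∧ (W₀.a₂ = -1 ∨ W₀.a₂ = 0 ∨ W₀.a₂ = 1) ∧
      W₀.c₄ ≠ 0 ∧ W₀.c₆ ≠ 0 ∧ (((W₀.baseChange ℚ).conductorNorm ℤ : ℕ) : ℝ) ≤ X ∧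
      (((W₀.baseChange ℚ).conductorNorm ℤ : ℕ) : ℝ) ^ κ ≤ ((max |W₀.Δ| (|W₀.c₄| ^ 3) : ℤ) : ℝ) ∧
      ((max |W₀.Δ| (|W₀.c₄| ^ 3) : ℤ) : ℝ) ≤ (((W₀.baseChange ℚ).conductorNorm ℤ : ℕ) : ℝ) ^ σ} →
      ((W.a₁, W.a₂, W.a₃), (W.c₄, W.c₆)) ∈ (↑T : Set (ℤ × ℤ × ℤ)) ×ˢ U := by
    intro W hW
    obtain ⟨hE, hmin, h₁, h₃, h₂, hc₄, hc₆, hNX, hlo, hhi⟩ := hW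
    refine Set.mk_mem_prod ?_ ?_
    · simp only [hT, Finset.coe_product, Finset.coe_insert, Finset.coe_singleton, Set.mem_prod,
        Set.mem_insert_iff, Set.mem_singleton_iff]
      exact ⟨h₁, h₂, h₃⟩
    · have hmem := mem_cuspShell_of_window hκ0 hmin hc₄ hc₆ hNX hlo
      have hjJ := log_Mcusp_le hσ0 hNX hhi
      rw [hU]
      simp only [Set.mem_iUnion, Finset.mem_range]
      exact ⟨Nat.log 2 (Mcusp (W.c₄, W.c₆)), Nat.lt_succ_of_le hjJ, hmem⟩
  have h1 := Set.ncard_le_ncard_of_injOn (fun W : WeierstrassCurve ℤ => ((W.a₁, W.a₂, W.a₃), (W.c₄, W.c₆)))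
    hmaps (model_injective.injOn) hfin
  have h2 : ((↑T : Set (ℤ × ℤ × ℤ)) ×ˢ U).ncard = 12 * U.ncard := by
    rw [Set.ncard_prod, Set.ncard_coe_finset, card_reducedTriples]
  have h3 : U.ncard ≤ ∑ j ∈ Finset.range (J + 1), (cuspShell (Xj j) ((2 : ℝ) ^ j)).ncard :=
    Finset.set_ncard_biUnion_le _ _
  -- Step 2: the per-shell bound
  have hXpow1 : 1 ≤ X ^ (1 - κ / 6) := Real.one_le_rpow hX (by linarith)
  have hshell : ∀ j ∈ Finset.range (J + 1),
      ((cuspShell (Xj j) ((2 : ℝ) ^ j)).ncard : ℝ) ≤ 3 * C₀ * X ^ (ε / 2) * X ^ (1 - κ / 6) := by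
    intro j hj
    have hjJ : j ≤ J := Nat.lt_succ_iff.mp (Finset.mem_range.mp hj)
    have hXj1 : 1 ≤ Xj j := le_min hX (Real.one_le_rpow (by norm_num) (by positivity))
    have hXjX : Xj j ≤ X := min_le_left _ _
    have hXj0 : 0 ≤ Xj j := by linarith
    have h2j1 : (1 : ℝ) ≤ (2 : ℝ) ^ j := one_le_pow₀ (by norm_num)
    have h2jσ : (2 : ℝ) ^ j ≤ X ^ σ := by
      have hfl0 : ⌊X ^ σ⌋₊ ≠ 0 := by
        have : 1 ≤ ⌊X ^ σ⌋₊ := Nat.le_floor (by exact_mod_cast Real.one_le_rpow hX hσ0)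
        omega
      have hA : ((2 ^ J : ℕ) : ℝ) ≤ (⌊X ^ σ⌋₊ : ℝ) := by exact_mod_cast Nat.pow_log_le_self 2 hfl0
      push_cast at hA
      calc (2 : ℝ) ^ j ≤ (2 : ℝ) ^ J := pow_le_pow_right₀ (by norm_num) hjJ
        _ ≤ ⌊X ^ σ⌋₊ := hA
        _ ≤ X ^ σ := Nat.floor_le (by positivity)
    -- the two cone conditions at `(X_j, 2^j)`
    set A : ℝ := (2 : ℝ) ^ (((j + 1 : ℕ) : ℝ) / κ) with hA
    have hA1 : 1 ≤ A := Real.one_le_rpow (by norm_num) (by positivity)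
    have hAκ : A ^ κ = 2 * (2 : ℝ) ^ j := by
      rw [hA, ← Real.rpow_mul (by norm_num), div_mul_cancel₀ _ hκ0.ne', Real.rpow_natCast, pow_succ, mul_comm]
    have hXjA : Xj j ≤ A := min_le_right _ _
    have hcone1 : Xj j ^ 3 ≤ 2 * (2 : ℝ) ^ j := by
      calc Xj j ^ 3 = Xj j ^ ((3 : ℕ) : ℝ) := (Real.rpow_natCast _ 3).symm
        _ ≤ Xj j ^ κ := Real.rpow_le_rpow_of_exponent_le hXj1 (by norm_num; linarith)
        _ ≤ A ^ κ := Real.rpow_le_rpow hXj0 hXjA hκ0.le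
        _ = 2 * (2 : ℝ) ^ j := hAκ
    have hcone2 : (2 : ℝ) ^ j ≤ Xj j ^ σ := by
      rcases min_cases X A with ⟨hmin, -⟩ | ⟨hmin, -⟩
      · simp only [hXj] at hmin ⊢
        rw [hmin]; exact h2jσ
      · simp only [hXj] at hmin ⊢
        rw [hmin]
        calc (2 : ℝ) ^ j ≤ 2 * (2 : ℝ) ^ j := by linarith [h2j1]
          _ = A ^ κ := hAκ.symm
          _ ≤ A ^ σ := Real.rpow_le_rpow_of_exponent_le hA1 (by linarith)
    have hb := hC (Xj j) ((2 : ℝ) ^ j) hXj1 h2j1 hcone1 hcone2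
    -- `(X_j 2^j)^{ε'} ≤ X^{ε/2}`
    have hloss : (Xj j * (2 : ℝ) ^ j) ^ (ε / (2 * (σ + 1))) ≤ X ^ (ε / 2) := by
      calc (Xj j * (2 : ℝ) ^ j) ^ (ε / (2 * (σ + 1))) ≤ (X * X ^ σ) ^ (ε / (2 * (σ + 1))) :=
            Real.rpow_le_rpow (by positivity) (mul_le_mul hXjX h2jσ (by positivity) hX0.le) hε'.le
        _ = X ^ (ε / 2) := by
            rw [← Real.rpow_one_add' hX0.le (by positivity), ← Real.rpow_mul hX0.le]
            congr 1
            field_simp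
            ring
    -- main term
    have hmain : Xj j * ((2 : ℝ) ^ j) ^ (-(1 / 6 : ℝ)) + 1 ≤ 3 * X ^ (1 - κ / 6) := by
      have := shell_main_le hκ0 hκ6.le hX j
      linarith
    have hnn : 0 ≤ (Xj j * (2 : ℝ) ^ j) ^ (ε / (2 * (σ + 1))) * (Xj j * ((2 : ℝ) ^ j) ^ (-(1 / 6 : ℝ)) + 1) :=
      by positivity
    calc ((cuspShell (Xj j) ((2 : ℝ) ^ j)).ncard : ℝ)
        ≤ C * (Xj j * (2 : ℝ) ^ j) ^ (ε / (2 * (σ + 1))) * (Xj j * ((2 : ℝ) ^ j) ^ (-(1 / 6 : ℝ)) + 1) := hb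
      _ ≤ C₀ * ((Xj j * (2 : ℝ) ^ j) ^ (ε / (2 * (σ + 1))) * (Xj j * ((2 : ℝ) ^ j) ^ (-(1 / 6 : ℝ)) + 1)) := by
          rw [mul_assoc]; exact mul_le_mul_of_nonneg_right (le_max_left _ _) hnn
      _ ≤ C₀ * (X ^ (ε / 2) * (3 * X ^ (1 - κ / 6))) := by
          apply mul_le_mul_of_nonneg_left _ hC₀0
          exact mul_le_mul hloss hmain (by positivity) (by positivity)
      _ = 3 * C₀ * X ^ (ε / 2) * X ^ (1 - κ / 6) := by ring
  -- Step 3: assemble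
  have hcount := card_shells_le hσ0 hε hX
  have hB0 : 0 ≤ 3 * C₀ * X ^ (ε / 2) * X ^ (1 - κ / 6) := by positivity
  calc (Set.ncard {W₀ : WeierstrassCurve ℤ | (W₀.baseChange ℚ).IsElliptic ∧
          (∀ v : IsDedekindDomain.HeightOneSpectrum ℤ, (W₀.baseChange ℚ).IsMinimalAt v) ∧
          (W₀.a₁ = 0 ∨ W₀.a₁ = 1) ∧ (W₀.a₃ = 0 ∨ W₀.a₃ = 1) ∧ (W₀.a₂ = -1 ∨ W₀.a₂ = 0 ∨ W₀.a₂ = 1) ∧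
          W₀.c₄ ≠ 0 ∧ W₀.c₆ ≠ 0 ∧ (((W₀.baseChange ℚ).conductorNorm ℤ : ℕ) : ℝ) ≤ X ∧
          (((W₀.baseChange ℚ).conductorNorm ℤ : ℕ) : ℝ) ^ κ ≤ ((max |W₀.Δ| (|W₀.c₄| ^ 3) : ℤ) : ℝ) ∧
          ((max |W₀.Δ| (|W₀.c₄| ^ 3) : ℤ) : ℝ) ≤ (((W₀.baseChange ℚ).conductorNorm ℤ : ℕ) : ℝ) ^ σ} : ℝ)
      ≤ (((↑T : Set (ℤ × ℤ × ℤ)) ×ˢ U).ncard : ℝ) := by exact_mod_cast h1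
    _ = 12 * (U.ncard : ℝ) := by rw [h2]; push_cast; ring
    _ ≤ 12 * ∑ j ∈ Finset.range (J + 1), ((cuspShell (Xj j) ((2 : ℝ) ^ j)).ncard : ℝ) := by
        have : (U.ncard : ℝ) ≤ ∑ j ∈ Finset.range (J + 1), ((cuspShell (Xj j) ((2 : ℝ) ^ j)).ncard : ℝ) := by
          exact_mod_cast h3
        linarith
    _ ≤ 12 * ∑ _j ∈ Finset.range (J + 1), 3 * C₀ * X ^ (ε / 2) * X ^ (1 - κ / 6) := by
        gcongr with j hj
        exact hshell j hj
    _ = 12 * (((J + 1 : ℕ) : ℝ) * (3 * C₀ * X ^ (ε / 2) * X ^ (1 - κ / 6))) := by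
        rw [Finset.sum_const, Finset.card_range, nsmul_eq_mul]
    _ ≤ 12 * (((2 * σ / (ε * Real.log 2) + 1) * X ^ (ε / 2)) * (3 * C₀ * X ^ (ε / 2) * X ^ (1 - κ / 6))) := by
        gcongr
    _ = 12 * (3 * C₀) * (2 * σ / (ε * Real.log 2) + 1) * (X ^ (ε / 2) * X ^ (ε / 2) * X ^ (1 - κ / 6)) := by
        ring
    _ = 12 * (3 * C₀) * (2 * σ / (ε * Real.log 2) + 1) * X ^ (1 - κ / 6 + ε) := by
        rw [← Real.rpow_add hX0, ← Real.rpow_add hX0]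
        congr 2
        ring






end Summit.ABC.ABC.Theorems.SharpModerateLaw

end
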